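import Literature.Analysis.FluidPDE.TsaiMaximumPrinciple
import Literature.Analysis.FluidPDE.TsaiProfileEndgame

/-!
# Route CoriolisHead · crux `CounterRotatingLiouville` (stmt-NavierStokesRegularity-22677) —
# stub 3 `stub_skewLiouville51`: Tsai's Lemma 5.1 for the skew drift `U + ay − By`

Support file of the line `tsai-rotating-head-chain` (theorems only; `--supports
stmt-NavierStokesRegularity-22677`).  Tsai's Liouville-type lemma (1998, Lemma 5.1; in the tree
with the corrected growth hypothesis as `isConst_of_driftOp_nonneg`) says that a `C²`
subsolution `νΔΘ − (U + ay)·∇Θ ≥ 0` with `|U| ≤ M + b|y|`, `b < a`, and Gaussian growth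
`|Θ| ≤ C e^{κ|y|²}`, `κ < (a − b)/(2ν)`, is constant.  Here the drift is `U − By + ay` with `B`
SKEW and of ARBITRARY size (`‖B‖ ≥ a` allowed): the skew part is invisible radially —
`⟪y − x₀, By⟫ = ⟪y − x₀, Bx₀⟫` — so on the centred Gaussian barriers of the proof the operator with
drift `U − By` coincides with the operator with the frozen, bounded drift `U − Bx₀`
(`driftOp_gaussAt_skew_eq`), and the tree's barrier estimates apply verbatim with `M` replaced
by `M + ‖Bx₀‖`.  The rest of the proof is the tree's `isConst_of_driftOp_nonneg`
(Lemarié-Rieusset, Lemma 16.8, Gaussian penalisation), copied with that one change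
(`isConst_of_driftOp_nonneg_skew`), plus the polynomial-growth corollary and the registered stub
(bounded `U`, so `b = 0`).  NS regularity is NOT proved here.
-/

noncomputable section

-- the summit and its single sub-problem share the name (CONVENTIONS §1), as in every Theorems file
set_option linter.dupNamespace false

open MeasureTheory Set Function Filter Topology InnerProductSpace Metric
open scoped RealInnerProductSpace Laplacian ContDiff BigOperators
open Literature.Analysis.FluidPDE

namespace Summit.NavierStokesRegularity.NavierStokesRegularity.Theorems.CoriolisHead

section Skew

variable {E : Type*} [NormedAddCommGroup E] [InnerProductSpace ℝ E] [FiniteDimensional ℝ E]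

/-- **The skew part of the drift is invisible on centred Gaussians**: for skew `B`,
`L_{U−B·}(e^{k|·−x₀|²}) = L_{U−Bx₀}(e^{k|·−x₀|²})`, because `∇ e^{k|y−x₀|²} ∥ (y − x₀)` and
`⟪y − x₀, By⟫ = ⟪y − x₀, Bx₀⟫`. -/
theorem driftOp_gaussAt_skew_eq {ν a k : ℝ} {B : E →L[ℝ] E} (hB : ∀ x, ⟪B x, x⟫ = 0)
    (U : E → E) (x₀ y : E) :
    driftOp ν a (fun z => U z - B z) (gaussAt k x₀) y =
      driftOp ν a (fun z => U z - B x₀) (gaussAt k x₀) y := by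
  unfold driftOp
  rw [fderiv_gaussAt_apply, fderiv_gaussAt_apply]
  have h : ⟪y - x₀, B y⟫ = ⟪y - x₀, B x₀⟫ := by
    have h1 : ⟪y - x₀, B (y - x₀)⟫ = 0 := by rw [real_inner_comm]; exact hB _
    rw [map_sub, inner_sub_right] at h1
    linarith
  simp only [inner_add_right, inner_sub_right, h]

/-- **Tsai's Lemma 5.1 for a skew drift, affine bound, Gaussian growth.** Let `ν > 0`,
`0 ≤ b < a`, `κ < (a − b)/(2ν)`, `B` skew, `Θ ∈ C²(E)` with `νΔΘ − DΘ[U − By + ay] ≥ 0`,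
`|U(y)| ≤ M + b|y|` and `|Θ(y)| ≤ C e^{κ|y|²}`.  Then `Θ` is constant.  (The tree's
`isConst_of_driftOp_nonneg` is `B = 0`; the proof is identical except that the three barrier
estimates are taken for the frozen drift `U − BX₀` via `driftOp_gaussAt_skew_eq`.) -/
theorem isConst_of_driftOp_nonneg_skew {ν a b M κ C : ℝ} (hν : 0 < ν) (hb : 0 ≤ b) (hba : b < a)
    (hκ : κ < (a - b) / (2 * ν)) {Θ : E → ℝ} {U : E → E} {B : E →L[ℝ] E}
    (hB : ∀ x, ⟪B x, x⟫ = 0) (hΘ : ContDiff ℝ 2 Θ)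
    (hsub : ∀ y, 0 ≤ driftOp ν a (fun z => U z - B z) Θ y) (hU : ∀ y, ‖U y‖ ≤ M + b * ‖y‖)
    (hgrowth : ∀ y, |Θ y| ≤ C * Real.exp (κ * ‖y‖ ^ 2)) (x y : E) : Θ x = Θ y := by
  -- reduce to: no pair `X₀, X₁` with `Θ X₀ < Θ X₁`
  suffices key : ∀ X₀ X₁ : E, ¬ (Θ X₀ < Θ X₁) by
    rcases lt_trichotomy (Θ x) (Θ y) with h | h | h
    · exact absurd h (key x y)
    · exact h
    · exact absurd h (key y x)
  intro X₀ X₁ hlt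
  -- basic constants
  have ha : 0 < a := hb.trans_lt hba
  have hab : 0 < a - b := sub_pos.2 hba
  have hM : 0 ≤ M := by
    have := hU 0
    rw [norm_zero, mul_zero, add_zero] at this
    exact (norm_nonneg _).trans this
  have hC : 0 ≤ C := by
    have := hgrowth 0
    rw [norm_zero] at this
    norm_num at this
    exact (abs_nonneg _).trans this
  have hd0 : (0 : ℝ) ≤ (Module.finrank ℝ E : ℝ) := Nat.cast_nonneg _
  obtain ⟨δ, hδ0, hδ⟩ : ∃ δ : ℝ, 0 < δ ∧ Θ X₁ = Θ X₀ + δ := ⟨Θ X₁ - Θ X₀, sub_pos.2 hlt, by ring⟩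
  have hX : X₁ ≠ X₀ := fun h => by rw [h] at hlt; exact lt_irrefl _ hlt
  have hs₁0 : 0 < ‖X₁ - X₀‖ := norm_pos_iff.2 (sub_ne_zero.2 hX)
  -- the drift with the skew part frozen at the centre: `Ũ = U − B X₀`, `|Ũ| ≤ (M + ‖B X₀‖) + b|y|`
  have hU' : ∀ z, ‖(fun z => U z - B X₀) z‖ ≤ (M + ‖B X₀‖) + b * ‖z‖ := fun z => by
    calc ‖U z - B X₀‖ ≤ ‖U z‖ + ‖B X₀‖ := norm_sub_le _ _
      _ ≤ (M + ‖B X₀‖) + b * ‖z‖ := by linarith [hU z]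
  obtain ⟨M₁, hM₁0, hM₁⟩ : ∃ M₁ : ℝ, 0 ≤ M₁ ∧ M₁ = (M + ‖B X₀‖) + (a + b) * ‖X₀‖ :=
    ⟨_, by positivity, rfl⟩
  have hΘc : Continuous Θ := hΘ.continuous
  -- `R₀`: a small ball about `X₀` on which `Θ ≤ Θ X₀ + δ/2`
  obtain ⟨R₀, hR₀0, hR₀s, hR₀Θ⟩ : ∃ R₀ : ℝ, 0 < R₀ ∧ R₀ < ‖X₁ - X₀‖ ∧
      ∀ y, ‖y - X₀‖ ≤ R₀ → Θ y ≤ Θ X₀ + δ / 2 := by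
    obtain ⟨η, hη0, hη⟩ := Metric.continuousAt_iff.1 hΘc.continuousAt (δ / 2) (half_pos hδ0)
    refine ⟨min (η / 2) (‖X₁ - X₀‖ / 2), lt_min (half_pos hη0) (half_pos hs₁0),
      (min_le_right _ _).trans_lt (half_lt_self hs₁0), fun y hy => ?_⟩
    have hdist : dist y X₀ < η := by
      rw [dist_eq_norm]; exact (hy.trans (min_le_left _ _)).trans_lt (half_lt_self hη0)
    have := hη hdist
    rw [Real.dist_eq] at this
    linarith [(abs_lt.1 this).2]
  -- `β` and the barrier `φ = exp(-β |y - X₀|²)`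
  obtain ⟨β, hβ0, hβeq⟩ : ∃ β : ℝ, 0 < β ∧
      4 * ν * β * R₀ ^ 2 = 2 * M₁ * R₀ + 2 * (Module.finrank ℝ E : ℝ) * ν + 1 := by
    refine ⟨(2 * M₁ * R₀ + 2 * (Module.finrank ℝ E : ℝ) * ν + 1) / (4 * ν * R₀ ^ 2),
      by positivity, ?_⟩
    field_simp
  obtain ⟨φ, hφ⟩ : ∃ φ : E → ℝ, φ = gaussAt (-β) X₀ := ⟨_, rfl⟩
  have hφ2 : ContDiff ℝ 2 φ := hφ ▸ contDiff_gaussAt _ _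
  have hφle1 : ∀ y, φ y ≤ 1 := fun y => hφ ▸ gaussAt_le_one_of_nonpos (by linarith) _ _
  have hφpos : ∀ y, 0 < φ y := fun y => hφ ▸ gaussAt_pos _ _ _
  have hφL : ∀ y, R₀ ≤ ‖y - X₀‖ → β * φ y ≤ driftOp ν a (fun z => U z - B z) φ y := by
    intro y hy
    have h1 := driftOp_gaussAt_neg_lower (ν := ν) hb hba.le hβ0.le hU' X₀ y
    have hq := one_le_barrier_quad hν.le hM₁0 hd0 hR₀0 hβeq hy
    rw [← hM₁, ← driftOp_gaussAt_skew_eq hB U X₀ y] at h1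
    rw [hφ]
    refine le_trans ?_ h1
    have h0 : 0 ≤ β * gaussAt (-β) X₀ y := mul_nonneg hβ0.le (gaussAt_pos _ _ _).le
    have := mul_le_mul_of_nonneg_left hq h0
    linarith
  -- `κ₁` and the penalisation `ψ = exp(κ₁ |y - X₀|²)`
  obtain ⟨κ₀, hκ₀0, hκκ₀, hκ₀lt⟩ : ∃ κ₀ : ℝ, 0 ≤ κ₀ ∧ κ ≤ κ₀ ∧ κ₀ < (a - b) / (2 * ν) :=
    ⟨max κ 0, le_max_right _ _, le_max_left _ _, max_lt hκ (by positivity)⟩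
  obtain ⟨κ₁, hκ₀₁, hκ₁lt⟩ : ∃ κ₁ : ℝ, κ₀ < κ₁ ∧ κ₁ < (a - b) / (2 * ν) :=
    ⟨(κ₀ + (a - b) / (2 * ν)) / 2, by linarith, by linarith⟩
  have hκ₁0 : 0 < κ₁ := hκ₀0.trans_lt hκ₀₁
  obtain ⟨Bc, hB0, hBB⟩ : ∃ Bc : ℝ, 0 < Bc ∧ Bc = 2 * (a - b) - 4 * ν * κ₁ := by
    refine ⟨_, ?_, rfl⟩
    have : 4 * ν * κ₁ < 4 * ν * ((a - b) / (2 * ν)) := by gcongr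
    have e : 4 * ν * ((a - b) / (2 * ν)) = 2 * (a - b) := by field_simp; ring
    linarith
  obtain ⟨R₁, hR₁1, hR₁s, hR₁B⟩ : ∃ R₁ : ℝ, 1 ≤ R₁ ∧ ‖X₁ - X₀‖ + 1 ≤ R₁ ∧
      (2 * M₁ + 2 * (Module.finrank ℝ E : ℝ) * ν + 1) / Bc ≤ R₁ :=
    ⟨max (max 1 (‖X₁ - X₀‖ + 1)) ((2 * M₁ + 2 * (Module.finrank ℝ E : ℝ) * ν + 1) / Bc),
      (le_max_left _ _).trans (le_max_left _ _), (le_max_right _ _).trans (le_max_left _ _),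
      le_max_right _ _⟩
  have hR₀R₁ : R₀ < R₁ := by linarith
  have hs₁R₁ : ‖X₁ - X₀‖ ≤ R₁ := by linarith
  obtain ⟨ψ, hψ⟩ : ∃ ψ : E → ℝ, ψ = gaussAt κ₁ X₀ := ⟨_, rfl⟩
  have hψ2 : ContDiff ℝ 2 ψ := hψ ▸ contDiff_gaussAt _ _
  have hψpos : ∀ y, 0 < ψ y := fun y => hψ ▸ gaussAt_pos _ _ _
  have hψle : ∀ y, ‖y - X₀‖ ≤ R₁ → ψ y ≤ Real.exp (κ₁ * R₁ ^ 2) := fun y hy =>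
    hψ ▸ gaussAt_mono_radius hκ₁0.le _ hy
  have hψeq : ∀ y, ψ y = Real.exp (κ₁ * ‖y - X₀‖ ^ 2) := fun y => by rw [hψ]; rfl
  have hψL_far : ∀ y, R₁ ≤ ‖y - X₀‖ → driftOp ν a (fun z => U z - B z) ψ y ≤ -(κ₁ * ψ y) := by
    intro y hy
    have h1 := driftOp_gaussAt_upper (ν := ν) hb hba.le hκ₁0.le hU' X₀ y
    rw [← hM₁, ← hBB, ← driftOp_gaussAt_skew_eq hB U X₀ y] at h1
    have hBr : 2 * M₁ + 2 * (Module.finrank ℝ E : ℝ) * ν + 1 ≤ Bc * ‖y - X₀‖ := by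
      have := (div_le_iff₀ hB0).1 (hR₁B.trans hy)
      nlinarith
    have hq := one_le_penal_quad hν.le hd0 (hR₁1.trans hy) hBr
    rw [hψ]
    refine h1.trans ?_
    have h0 : 0 ≤ κ₁ * gaussAt κ₁ X₀ y := mul_nonneg hκ₁0.le (gaussAt_pos _ _ _).le
    have := mul_le_mul_of_nonneg_left hq h0
    linarith
  obtain ⟨K, hK0, hK⟩ : ∃ K : ℝ, 0 ≤ K ∧ K = κ₁ * Real.exp (κ₁ * R₁ ^ 2) *
      (4 * ν * κ₁ * R₁ ^ 2 + 2 * (Module.finrank ℝ E : ℝ) * ν +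
        2 * (M₁ + (a + b) * R₁) * R₁) := ⟨_, by positivity, rfl⟩
  have hψL_near : ∀ y, ‖y - X₀‖ ≤ R₁ → |driftOp ν a (fun z => U z - B z) ψ y| ≤ K := by
    intro y hy
    have h1 := abs_driftOp_gaussAt_le hν.le hb hba.le hκ₁0.le hU' X₀ y
    rw [← hM₁, ← driftOp_gaussAt_skew_eq hB U X₀ y] at h1
    rw [hψ]
    refine h1.trans ?_
    rw [hK]
    have hr0 : 0 ≤ ‖y - X₀‖ := norm_nonneg _
    gcongr
    exact gaussAt_mono_radius hκ₁0.le _ hy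
  -- the constants `γ`, `α` and the auxiliary function `V = Θ + α (φ - γ ψ)`
  obtain ⟨Φm, hΦm0, hφL_mid⟩ : ∃ Φm : ℝ, 0 < Φm ∧
      ∀ y, R₀ ≤ ‖y - X₀‖ → ‖y - X₀‖ ≤ R₁ → Φm ≤ driftOp ν a (fun z => U z - B z) φ y := by
    refine ⟨β * Real.exp (-β * R₁ ^ 2), by positivity, fun y hy hy' => ?_⟩
    refine le_trans ?_ (hφL y hy)
    rw [hφ]
    exact mul_le_mul_of_nonneg_left (gaussAt_anti_radius (by linarith) X₀ hy') hβ0.le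
  obtain ⟨γ, hγ0, hγK⟩ : ∃ γ : ℝ, 0 < γ ∧ γ * K < Φm := by
    refine ⟨Φm / (2 * (K + 1)), by positivity, ?_⟩
    rw [div_mul_eq_mul_div, div_lt_iff₀ (by positivity)]
    nlinarith
  obtain ⟨S, hS0, hS⟩ : ∃ S : ℝ, 0 < S ∧ S = 1 + γ * Real.exp (κ₁ * R₁ ^ 2) :=
    ⟨_, by positivity, rfl⟩
  have hφψ : ∀ y, ‖y - X₀‖ ≤ R₁ → |φ y - γ * ψ y| ≤ S := by
    intro y hy
    refine (abs_sub _ _).trans ?_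
    rw [abs_of_pos (hφpos y), abs_of_pos (mul_pos hγ0 (hψpos y)), hS]
    gcongr
    · exact hφle1 y
    · exact hψle y hy
  obtain ⟨α, hα0, hαS⟩ : ∃ α : ℝ, 0 < α ∧ α * S = δ / 8 :=
    ⟨δ / (8 * S), by positivity, by field_simp⟩
  obtain ⟨V, hV⟩ : ∃ V : E → ℝ, V = Θ + α • (φ - γ • ψ) := ⟨_, rfl⟩
  have hVapply : ∀ y, V y = Θ y + α * (φ y - γ * ψ y) := fun y => by
    simp only [hV, Pi.add_apply, Pi.smul_apply, Pi.sub_apply, smul_eq_mul]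
  have hV2 : ContDiff ℝ 2 V :=
    hV ▸ hΘ.add (contDiff_const.smul (hφ2.sub (contDiff_const.smul hψ2)))
  have hLV : ∀ y, driftOp ν a (fun z => U z - B z) V y =
      driftOp ν a (fun z => U z - B z) Θ y + α * (driftOp ν a (fun z => U z - B z) φ y -
        γ * driftOp ν a (fun z => U z - B z) ψ y) := fun y =>
    hV ▸ driftOp_add_smul_sub ν a (fun z => U z - B z) hΘ hφ2 hψ2 α γ y
  -- `V X₁` is large, `V` is small on the small ball
  have hVX₁ : Θ X₀ + 7 * δ / 8 ≤ V X₁ := by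
    rw [hVapply]
    have h1 := hφψ X₁ hs₁R₁
    have h2 : -S ≤ φ X₁ - γ * ψ X₁ := (neg_le_neg h1).trans (neg_abs_le _)
    have h3 := mul_le_mul_of_nonneg_left h2 hα0.le
    rw [mul_neg, hαS] at h3
    linarith
  have hVsmall : ∀ y, ‖y - X₀‖ ≤ R₀ → V y < V X₁ := by
    intro y hy
    rw [hVapply]
    have h1 := hφψ y (hy.trans hR₀R₁.le)
    have h2 : φ y - γ * ψ y ≤ S := (le_abs_self _).trans h1
    have h3 := mul_le_mul_of_nonneg_left h2 hα0.le
    rw [hαS] at h3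
    have h4 := hR₀Θ y hy
    linarith
  -- decay at infinity: `V ≤ V X₁` outside a large ball
  obtain ⟨R₂, hR₁R₂, hVfar⟩ : ∃ R₂ : ℝ, R₁ ≤ R₂ ∧ ∀ y, R₂ ≤ ‖y - X₀‖ → V y ≤ V X₁ :=
    le_far_of_gauss_penalisation hC hgrowth hκκ₀ hκ₀0 hκ₀₁ hκ₁0 hψeq hφle1 hα0 hγ0
      hVapply X₁ R₁
  -- a global maximum `X₂` of `V`, where `L V ≤ 0`
  obtain ⟨X₂, hX₂⟩ : ∃ X₂, ∀ y, V y ≤ V X₂ :=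
    exists_forall_le_of_le_outside hV2.continuous (hs₁R₁.trans hR₁R₂) hVfar
  have hLV2 : driftOp ν a (fun z => U z - B z) V X₂ ≤ 0 :=
    driftOp_nonpos_of_isMax hν.le (fun z => U z - B z) hV2 hX₂
  rw [hLV] at hLV2
  have hΘ2 := hsub X₂
  -- case analysis on the position of `X₂`
  rcases le_or_gt ‖X₂ - X₀‖ R₀ with h1 | h1
  · exact absurd (hX₂ X₁) (not_le.2 (hVsmall X₂ h1))
  have hpos : 0 < driftOp ν a (fun z => U z - B z) φ X₂ -
      γ * driftOp ν a (fun z => U z - B z) ψ X₂ := by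
    rcases le_or_gt ‖X₂ - X₀‖ R₁ with h2 | h2
    · have hφ2' := hφL_mid X₂ h1.le h2
      have hψ2' := (le_abs_self _).trans (hψL_near X₂ h2)
      have := mul_le_mul_of_nonneg_left hψ2' hγ0.le
      linarith
    · have hφ2' := hφL X₂ (hR₀R₁.le.trans h2.le)
      have hψ2' := hψL_far X₂ h2.le
      have e1 := mul_pos hβ0 (hφpos X₂)
      have e2 := mul_pos hγ0 (mul_pos hκ₁0 (hψpos X₂))
      have := mul_le_mul_of_nonneg_left hψ2' hγ0.le
      have e3 : γ * -(κ₁ * ψ X₂) = -(γ * (κ₁ * ψ X₂)) := by ring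
      linarith
  have := mul_pos hα0 hpos
  linarith

/-- Polynomial growth, bounded `U`: a `C²` subsolution `νΔΘ − DΘ[U − By + ay] ≥ 0` with `U`
bounded, `B` skew, `a, ν > 0` and `|Θ(y)| ≤ C(1 + |y|)^N` is constant (`b = 0`,
`κ = a/(4ν)`, `(1 + r)^N ≤ N! e^{1+1/(4κ)} e^{κr²}`). -/
theorem isConst_of_driftOp_nonneg_skew_of_poly {ν a C : ℝ} {N : ℕ} (hν : 0 < ν) (ha : 0 < a)
    {Θ : E → ℝ} {U : E → E} {B : E →L[ℝ] E} (hB : ∀ x, ⟪B x, x⟫ = 0) (hΘ : ContDiff ℝ 2 Θ)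
    (hsub : ∀ y, 0 ≤ driftOp ν a (fun z => U z - B z) Θ y) (hU : ∃ M : ℝ, ∀ y, ‖U y‖ ≤ M)
    (hgrowth : ∀ y, |Θ y| ≤ C * (1 + ‖y‖) ^ N) (x y : E) : Θ x = Θ y := by
  obtain ⟨M, hM⟩ := hU
  have hC : 0 ≤ C := by
    have h := (abs_nonneg _).trans (hgrowth 0)
    rw [norm_zero, add_zero, one_pow, mul_one] at h
    exact h
  set κ := a / (4 * ν) with hκ
  have hκ0 : 0 < κ := by positivity
  have hκlt : κ < (a - 0) / (2 * ν) := by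
    rw [hκ, sub_zero, div_lt_div_iff₀ (by positivity) (by positivity)]
    nlinarith
  refine isConst_of_driftOp_nonneg_skew (M := max M 0) (b := 0)
    (C := C * (N.factorial * Real.exp (1 + 1 / (4 * κ)))) hν le_rfl ha hκlt hB hΘ hsub
    (fun z => by rw [zero_mul, add_zero]; exact (hM z).trans (le_max_left _ _))
    (fun z => (hgrowth z).trans ?_) x y
  rw [mul_assoc]
  exact mul_le_mul_of_nonneg_left (one_add_pow_le_exp_mul_sq hκ0 N (norm_nonneg z)) hC

end Skew

/-- **Registered stub `stub_skewLiouville51`** of the skeleton of crux `CounterRotatingLiouville`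
(line `tsai-rotating-head-chain`): if the rotating head pressure `Π_B = ½|U|² + P + a⟨y,U⟩ −
⟨By,U⟩` of a smooth bounded rotated Leray profile (skew `B` of any size, `ν, a > 0`) is an
`L`-subsolution, `νΔΠ_B − (U − By + ay)·∇Π_B ≥ 0`, and polynomially bounded, then it is
constant (Tsai's Lemma 5.1 with the skew drift). -/
theorem stub_skewLiouville51 : ∀ (ν a : ℝ), 0 < ν → 0 < a → ∀ (B : EuclideanSpace ℝ (Fin 3) →L[ℝ] EuclideanSpace ℝ (Fin 3)) (U : EuclideanSpace ℝ (Fin 3) → EuclideanSpace ℝ (Fin 3)) (P : EuclideanSpace ℝ (Fin 3) → ℝ), ContDiff ℝ (⊤ : ℕ∞) U → ContDiff ℝ 2 P → (∀ x, inner ℝ (B x) x = 0) → Literature.Analysis.FluidPDE.VectorCalculus.IsDivFree U → (∀ y, -(ν • Laplacian.laplacian U y) + a • U y + a • fderiv ℝ U y y + (B (U y) - fderiv ℝ U y (B y)) + Literature.Analysis.FluidPDE.convect U U y + gradient P y = 0) → (∃ M : ℝ, ∀ y, ‖U y‖ ≤ M) → (∀ y, 0 ≤ Literature.Analysis.FluidPDE.driftOp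 ν a (fun z => U z - B z) (fun z => Literature.Analysis.FluidPDE.headPressure a U P z - inner ℝ (B z) (U z)) y) → (∃ C : ℝ, ∃ N : ℕ, ∀ y, |(fun z => Literature.Analysis.FluidPDE.headPressure a U P z - inner ℝ (B z) (U z)) y| ≤ C * (1 + ‖y‖) ^ N) → ∀ x y, (fun z => Literature.Analysis.FluidPDE.headPressure a U P z - inner ℝ (B z) (U z)) x = (fun z => Literature.Analysis.FluidPDE.headPressure a U P z - inner ℝ (B z) (U z)) y := by
  intro ν a hν ha B U P hU hP hB _hdiv _heq hbdd hsub hgrowth x y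
  have hU2 : ContDiff ℝ 2 U := hU.of_le (by norm_cast)
  have hΘ : ContDiff ℝ 2 (fun z => headPressure a U P z - ⟪B z, U z⟫) :=
    (contDiff_headPressure hU2 hP).sub ((B.contDiff (n := 2)).inner ℝ hU2)
  obtain ⟨C, N, hCN⟩ := hgrowth
  exact isConst_of_driftOp_nonneg_skew_of_poly hν ha hB hΘ hsub hbdd hCN x y

end Summit.NavierStokesRegularity.NavierStokesRegularity.Theorems.CoriolisHead

end
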